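import Mathlib.Topology.Sequences
import Mathlib.Topology.MetricSpace.ProperSpace
import Literature.Computability.AlgebraicComplexity.TensorPowerAction
import Literature.Computability.AlgebraicComplexity.MatrixKAK
import Literature.Computability.AlgebraicComplexity.KempfNessExpSum
import Literature.Computability.AlgebraicComplexity.KempfNessMinimizer
import Literature.NumberTheory.Automorphic.IwasawaDecompositionArchimedean
import HarnessLib

/-!
# Kempf–Ness: the `SL`-orbit of a critical tensor is closed

Support file for the proof of Bürgisser–Ikenmeyer 2017, Cor. 2.9 (`det_n` and `per_n` are
polystable, `Polystability.lean`). For the tensor power action `tensorAct` of `Matrix σ σ ℂ` on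
`n`-tensors `(Fin n → σ) → ℂ` (`TensorPowerAction.lean`) we prove the closedness half of the
**Kempf–Ness theorem** (Kempf–Ness 1979, Thm. 0.1 (a) with Thm. 0.2: the orbit of a critical
vector is closed) in the following elementary form (`isClosed_tensorOrbit_of_critical`):

  if for every unitary `U` and every real `θ` with `∑ θ = 0` the torus weights of `U • T₀` balance,
  `∑ j, (∑ k, θ (j k)) * ‖(U • T₀) j‖² = 0` (the moment map vanishes at `T₀`), then
  `{g • T₀ | det g = 1}` is closed in the classical topology.

Proof (no Hilbert–Mumford criterion, no algebraic groups). Let `g_m • T₀ → y`. Replace `g_m` by a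
minimiser `g'_m` of the Frobenius norm in its coset modulo the stabiliser
(`exists_frobSq_minimizer`) and write `g'_m = V_m diag(e^{θ^m}) W_m` (`exists_kak_of_det_eq_one`);
then `‖g_m • T₀‖² = ∑ j, e^{2⟨θ^m, ct j⟩} ‖(W_m • T₀) j‖²` is bounded. If the `θ^m` have a bounded
subsequence, compactness of `U(σ)` (the tree's `Matrix.isCompact_unitaryGroup`) gives a limit
`g ∈ SL` with `g • T₀ = y`. Otherwise `‖θ^m‖ → ∞`; normalise `ε^m = θ^m/‖θ^m‖ → e`,
`W_m → W` along a subsequence. Balanced exponential sums are monotone (`expSum_mono`), so the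
limit sum `∑ j, e^{2s⟨e, ct j⟩} ‖(W • T₀) j‖²` stays bounded for `s ≥ 0`, whence `⟨e, ct j⟩ = 0` on
the support of `W • T₀` (`eq_zero_of_expSum_le_of_balanced`): `exp(s · Wᴴ diag(e) W)` lies in the
stabiliser. The first-order condition at the minimisers (`firstOrder_of_frobSq_minimizer`) then
reads `∑ c, e^{2θ^m_c} p^m_c = 0` with `p^m_c → e_c`, which is impossible for large `m` since the
coordinate maximising `e` (which is `> 0` as `∑ e = 0`, `e ≠ 0`) dominates
(`eventually_pos_expSum`).

## References

* G. Kempf, L. Ness, *The length of vectors in representation spaces*, in: Algebraic Geometry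
  (Copenhagen 1978), LNM 732, Springer (1979), 233–243, Thm. 0.1, Thm. 0.2.
* P. Bürgisser, C. Ikenmeyer, *Fundamental invariants of orbit closures*, J. Algebra 477 (2017),
  §2.2 (polystability). [BurgisserIkenmeyer2017]
-/

noncomputable section

open Finset Filter
open scoped Matrix ComplexOrder Topology

namespace Literature.Computability.AlgebraicComplexity

/-! ### Kempf–Ness: the orbit of a critical tensor under `SL` is closed -/
section KempfNess

variable {σ : Type*} [Fintype σ] [DecidableEq σ] {n : ℕ}

/-- The `KAK` map `(V, θ, W) ↦ V * diag(exp θ) * W` is continuous. [folklore] -/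
theorem continuous_kakMap :
    Continuous fun x : Matrix σ σ ℂ × ((σ → ℝ) × Matrix σ σ ℂ) =>
      x.1 * Matrix.diagonal (fun c => (Real.exp (x.2.1 c) : ℂ)) * x.2.2 := by
  refine Continuous.matrix_mul (Continuous.matrix_mul continuous_fst ?_) (continuous_snd.comp continuous_snd)
  refine Continuous.matrix_diagonal ?_
  refine continuous_pi fun c => ?_
  exact Complex.continuous_ofReal.comp (Real.continuous_exp.comp
    ((continuous_apply c).comp (continuous_fst.comp continuous_snd)))

/-- **Kempf–Ness closedness theorem (tensor form).** If `T₀` is *critical* — for every unitary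
`U` and every real `θ` with `∑ θ = 0` the torus weights of `U • T₀` balance,
`∑ j, (∑ k, θ (j k)) * ‖(U • T₀) j‖² = 0` (i.e. the moment map vanishes at `T₀`) — then the orbit
`{g • T₀ | det g = 1}` of `T₀` under `SL_σ(ℂ)` is closed in the classical topology
(Kempf–Ness 1979, Thm. 0.1–0.2: a critical vector is of minimal length and its orbit is closed).
The proof here is the direct compactness argument: minimal-norm representatives modulo the
stabiliser, the `KAK` decomposition, and the first-order condition, with no appeal to the
Hilbert–Mumford criterion. [folklore] -/
theorem isClosed_tensorOrbit_of_critical (T₀ : (Fin n → σ) → ℂ)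
    (hcrit : ∀ U ∈ Matrix.unitaryGroup σ ℂ, ∀ θ : σ → ℝ, ∑ a, θ a = 0 →
      ∑ j : Fin n → σ, (∑ k, θ (j k)) * ‖tensorAct U T₀ j‖ ^ 2 = 0) :
    IsClosed {S : (Fin n → σ) → ℂ | ∃ g : Matrix σ σ ℂ, g.det = 1 ∧ tensorAct g T₀ = S} := by
  haveI : FirstCountableTopology (Matrix σ σ ℂ) :=
    inferInstanceAs (FirstCountableTopology (σ → σ → ℂ))
  rw [← closure_subset_iff_isClosed]
  intro y hy
  obtain ⟨S, hS, hlim⟩ := mem_closure_iff_seq_limit.mp hy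
  choose g hgdet hgS using hS
  -- minimal representatives and their `KAK` decompositions
  choose g' hg'det hg'S hg'min using fun m => exists_frobSq_minimizer T₀ (hgdet m)
  choose V W θ hV hW hθ hkak using fun m => exists_kak_of_det_eq_one (g' m) (hg'det m)
  have hVV : ∀ m, (V m)ᴴ * V m = 1 := fun m => by
    have := Matrix.mem_unitaryGroup_iff'.mp (hV m); rwa [Matrix.star_eq_conjTranspose] at this
  have hS' : ∀ m, tensorAct (g' m) T₀ = S m := fun m => (hg'S m).trans (hgS m)
  -- the norms `‖S m‖²` are bounded ...
  obtain ⟨C, hC⟩ : ∃ C, ∀ m, tnormSq (S m) ≤ C := by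
    have h := (continuous_tnormSq.tendsto y).comp hlim
    obtain ⟨C, hC⟩ := h.bddAbove_range
    exact ⟨C, fun m => hC ⟨m, rfl⟩⟩
  -- ... and given by the torus weights in the frame `W m`
  have hnormS : ∀ m, tnormSq (S m) =
      ∑ j : Fin n → σ, Real.exp (2 * ∑ k, θ m (j k)) * ‖tensorAct (W m) T₀ j‖ ^ 2 := by
    intro m
    rw [← hS' m, hkak m, tnormSq_tensorAct_kak (hVV m)]
  -- Case distinction: are the `θ m` frequently bounded?
  by_cases hfreq : ∃ R : ℝ, ∃ᶠ m in atTop, ‖θ m‖ ≤ R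
  · /- Case A: a bounded subsequence; compactness gives a limit `g∞ ∈ SL` with `g∞ • T₀ = y`. -/
    obtain ⟨R, hR⟩ := hfreq
    obtain ⟨φ₁, hφ₁, hφ₁R⟩ := Filter.extraction_of_frequently_atTop hR
    set K : Set (Matrix σ σ ℂ × ((σ → ℝ) × Matrix σ σ ℂ)) :=
      (Matrix.unitaryGroup σ ℂ : Set (Matrix σ σ ℂ)) ×ˢ
        (Metric.closedBall (0 : σ → ℝ) R ×ˢ (Matrix.unitaryGroup σ ℂ : Set (Matrix σ σ ℂ))) with hK
    have hKc : IsCompact K :=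
      Literature.NumberTheory.Automorphic.Matrix.isCompact_unitaryGroup.prod
        ((isCompact_closedBall _ _).prod
          Literature.NumberTheory.Automorphic.Matrix.isCompact_unitaryGroup)
    set x : ℕ → Matrix σ σ ℂ × ((σ → ℝ) × Matrix σ σ ℂ) :=
      fun m => (V (φ₁ m), (θ (φ₁ m), W (φ₁ m))) with hx
    have hxK : ∀ m, x m ∈ K := fun m =>
      ⟨hV _, ⟨by simpa using hφ₁R m, hW _⟩⟩
    obtain ⟨pt, hptK, φ₂, hφ₂, hxlim⟩ := hKc.tendsto_subseq hxK
    -- the limit matrix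
    set F : Matrix σ σ ℂ × ((σ → ℝ) × Matrix σ σ ℂ) → Matrix σ σ ℂ :=
      fun z => z.1 * Matrix.diagonal (fun c => (Real.exp (z.2.1 c) : ℂ)) * z.2.2 with hF
    have hFcont : Continuous F := continuous_kakMap
    have hFx : ∀ m, F (x (φ₂ m)) = g' (φ₁ (φ₂ m)) := fun m => by
      rw [hF, hx]; exact (hkak _).symm
    have hglim : Tendsto (fun m => g' (φ₁ (φ₂ m))) atTop (𝓝 (F pt)) := by
      have := (hFcont.tendsto pt).comp hxlim
      refine this.congr fun m => ?_
      exact hFx m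
    refine ⟨F pt, ?_, ?_⟩
    · -- `det (F pt) = 1`
      have h1 : Tendsto (fun m => (g' (φ₁ (φ₂ m))).det) atTop (𝓝 (F pt).det) :=
        ((continuous_id.matrix_det).tendsto _).comp hglim
      have h2 : Tendsto (fun m => (g' (φ₁ (φ₂ m))).det) atTop (𝓝 1) := by
        simp_rw [hg'det]; exact tendsto_const_nhds
      exact tendsto_nhds_unique h1 h2
    · -- `F pt • T₀ = y`
      have h1 : Tendsto (fun m => tensorAct (g' (φ₁ (φ₂ m))) T₀) atTop (𝓝 (tensorAct (F pt) T₀)) :=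
        ((continuous_tensorAct_left T₀).tendsto _).comp hglim
      have h2 : Tendsto (fun m => tensorAct (g' (φ₁ (φ₂ m))) T₀) atTop (𝓝 y) := by
        simp_rw [hS']
        exact hlim.comp (hφ₁.comp hφ₂).tendsto_atTop
      exact tendsto_nhds_unique h1 h2
  · /- Case B: `‖θ m‖ → ∞`; the blow-up analysis contradicts the first-order condition. -/
    exfalso
    have hdiv : Tendsto (fun m => ‖θ m‖) atTop atTop := by
      rw [Filter.tendsto_atTop]
      intro R
      have : ∀ᶠ m in atTop, ¬ (‖θ m‖ ≤ R) := Filter.not_frequently.mp (fun h => hfreq ⟨R, h⟩)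
      filter_upwards [this] with m hm
      exact (not_le.mp hm).le
    -- normalised weights
    set rr : ℕ → ℝ := fun m => ‖θ m‖ with hrr
    set ε : ℕ → σ → ℝ := fun m => (rr m)⁻¹ • θ m with hε
    have hpos_ev : ∀ᶠ m in atTop, 0 < rr m := hdiv.eventually_gt_atTop 0
    obtain ⟨φ₁, hφ₁, hφ₁pos⟩ := Filter.extraction_of_frequently_atTop hpos_ev.frequently
    have hεnorm : ∀ m, ‖ε (φ₁ m)‖ = 1 := fun m => by
      rw [hε]
      simp only
      rw [norm_smul, norm_inv, norm_norm, inv_mul_cancel₀ (hφ₁pos m).ne']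
    have hεsum : ∀ m, ∑ a, ε (φ₁ m) a = 0 := fun m => by
      rw [hε]
      simp only [Pi.smul_apply, smul_eq_mul, ← Finset.mul_sum, hθ, mul_zero]
    have hθε : ∀ m a, θ (φ₁ m) a = rr (φ₁ m) * ε (φ₁ m) a := fun m a => by
      rw [hε]
      simp only [Pi.smul_apply, smul_eq_mul]
      rw [← mul_assoc, mul_inv_cancel₀ (hφ₁pos m).ne', one_mul]
    -- compactness: `ε → e`, `W → Winf` along a further subsequence
    set K : Set ((σ → ℝ) × Matrix σ σ ℂ) :=
      Metric.sphere (0 : σ → ℝ) 1 ×ˢ (Matrix.unitaryGroup σ ℂ : Set (Matrix σ σ ℂ)) with hK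
    have hKc : IsCompact K :=
      (isCompact_sphere _ _).prod Literature.NumberTheory.Automorphic.Matrix.isCompact_unitaryGroup
    set x : ℕ → (σ → ℝ) × Matrix σ σ ℂ := fun m => (ε (φ₁ m), W (φ₁ m)) with hx
    have hxK : ∀ m, x m ∈ K := fun m =>
      ⟨mem_sphere_zero_iff_norm.mpr (hεnorm m), hW _⟩
    obtain ⟨⟨e, Winf⟩, ⟨he1, hWinf⟩, φ₂, hφ₂, hxlim⟩ := hKc.tendsto_subseq hxK
    set ψ : ℕ → ℕ := fun m => φ₁ (φ₂ m) with hψ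
    have hεlim : Tendsto (fun m => ε (ψ m)) atTop (𝓝 e) := (continuous_fst.tendsto _).comp hxlim
    have hWlim : Tendsto (fun m => W (ψ m)) atTop (𝓝 Winf) := (continuous_snd.tendsto _).comp hxlim
    have hεlim' : ∀ c, Tendsto (fun m => ε (ψ m) c) atTop (𝓝 (e c)) := fun c =>
      ((continuous_apply c).tendsto _).comp hεlim
    have hrlim : Tendsto (fun m => rr (ψ m)) atTop atTop := hdiv.comp (hφ₁.comp hφ₂).tendsto_atTop
    have hWinf' : Winfᴴ * Winf = 1 := by
      have := Matrix.mem_unitaryGroup_iff'.mp hWinf; rwa [Matrix.star_eq_conjTranspose] at this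
    have hWinf'' : Winf * star Winf = 1 := Matrix.mem_unitaryGroup_iff.mp hWinf
    -- properties of the limit weight `e`
    have hesum : ∑ a, e a = 0 := by
      have h1 : Tendsto (fun m => ∑ a, ε (ψ m) a) atTop (𝓝 (∑ a, e a)) :=
        tendsto_finsetSum _ fun a _ => hεlim' a
      have h2 : Tendsto (fun m => ∑ a, ε (ψ m) a) atTop (𝓝 0) := by
        simp_rw [hψ, hεsum]; exact tendsto_const_nhds
      exact tendsto_nhds_unique h1 h2
    have he_ne : e ≠ 0 := by
      intro h0
      rw [mem_sphere_zero_iff_norm, h0, norm_zero] at he1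
      exact zero_ne_one he1
    have hepos : ∃ c, 0 < e c := by
      by_contra hno
      push Not at hno
      apply he_ne
      funext c
      have := (Finset.sum_eq_zero_iff_of_nonpos fun a (_ : a ∈ Finset.univ) => hno a).mp hesum
      exact this c (Finset.mem_univ c)
    -- the limit exponential sum is bounded on `[0, ∞)`
    set cc : (Fin n → σ) → ℝ := fun j => ‖tensorAct Winf T₀ j‖ ^ 2 with hcc
    set ww : (Fin n → σ) → ℝ := fun j => 2 * ∑ k, e (j k) with hww
    have hcc0 : ∀ j, 0 ≤ cc j := fun j => by positivity
    have hbal : ∑ j, cc j * ww j = 0 := by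
      have := hcrit Winf hWinf e hesum
      rw [hcc, hww]
      simp only
      calc ∑ j, ‖tensorAct Winf T₀ j‖ ^ 2 * (2 * ∑ k, e (j k))
          = 2 * ∑ j : Fin n → σ, (∑ k, e (j k)) * ‖tensorAct Winf T₀ j‖ ^ 2 := by
            rw [Finset.mul_sum]; exact Finset.sum_congr rfl fun j _ => by ring
        _ = 0 := by rw [this, mul_zero]
    have hbdd : ∀ s, 0 ≤ s → ∑ j, cc j * Real.exp (s * ww j) ≤ C := by
      intro s hs
      -- along `ψ`, eventually `rr ≥ s`, and then the exponential sum at `s` is ≤ the one at `rr`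
      have hev : ∀ᶠ m in atTop, ∑ j, ‖tensorAct (W (ψ m)) T₀ j‖ ^ 2 *
          Real.exp (s * (2 * ∑ k, ε (ψ m) (j k))) ≤ C := by
        filter_upwards [hrlim.eventually_ge_atTop s] with m hm
        have hbalm : ∑ j, ‖tensorAct (W (ψ m)) T₀ j‖ ^ 2 * (2 * ∑ k, ε (ψ m) (j k)) = 0 := by
          have := hcrit (W (ψ m)) (hW _) (ε (ψ m)) (hεsum (φ₂ m))
          calc ∑ j, ‖tensorAct (W (ψ m)) T₀ j‖ ^ 2 * (2 * ∑ k, ε (ψ m) (j k))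
              = 2 * ∑ j : Fin n → σ, (∑ k, ε (ψ m) (j k)) * ‖tensorAct (W (ψ m)) T₀ j‖ ^ 2 := by
                rw [Finset.mul_sum]; exact Finset.sum_congr rfl fun j _ => by ring
            _ = 0 := by rw [this, mul_zero]
        have hmono := expSum_mono (c := fun j => ‖tensorAct (W (ψ m)) T₀ j‖ ^ 2)
          (w := fun j => 2 * ∑ k, ε (ψ m) (j k)) (fun j => by positivity) hbalm hs hm
        refine le_trans hmono (le_trans (le_of_eq ?_) (hC (ψ m)))
        rw [hnormS (ψ m)]
        refine Finset.sum_congr rfl fun j _ => ?_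
        rw [mul_comm]
        congr 2
        simp only [Finset.mul_sum]
        refine Finset.sum_congr rfl fun k _ => ?_
        rw [hθε]
        ring
      have hten : Tendsto (fun m => ∑ j, ‖tensorAct (W (ψ m)) T₀ j‖ ^ 2 *
          Real.exp (s * (2 * ∑ k, ε (ψ m) (j k)))) atTop (𝓝 (∑ j, cc j * Real.exp (s * ww j))) := by
        refine tendsto_finsetSum _ fun j _ => ?_
        refine Tendsto.mul ?_ ?_
        · have : Tendsto (fun m => tensorAct (W (ψ m)) T₀ j) atTop (𝓝 (tensorAct Winf T₀ j)) :=
            ((continuous_apply j).tendsto _).comp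
              (((continuous_tensorAct_left T₀).tendsto _).comp hWlim)
          exact (this.norm).pow 2
        · refine (Real.continuous_exp.tendsto _).comp ?_
          refine Tendsto.const_mul s (Tendsto.const_mul 2 ?_)
          exact tendsto_finsetSum _ fun k _ => hεlim' (j k)
      exact le_of_tendsto hten hev
    -- hence the active weights of `Winf • T₀` vanish
    have hsupp : ∀ j, tensorAct (star (star Winf)) T₀ j ≠ 0 → ∑ k, e (j k) = 0 := by
      intro j hj
      rw [star_star] at hj
      have hcj : 0 < cc j := by
        rw [hcc]; simp only
        exact pow_pos (norm_pos_iff.mpr hj) 2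
      have := eq_zero_of_expSum_le_of_balanced hcc0 hbal hbdd hcj
      rw [hww] at this
      simp only at this
      linarith
    -- first-order condition at every `g' (ψ m)` in the direction `(Winfᴴ, e)`
    have hstarW : star Winf ∈ Matrix.unitaryGroup σ ℂ := by
      rw [Matrix.mem_unitaryGroup_iff, star_star]
      exact Matrix.mem_unitaryGroup_iff'.mp hWinf
    have hfo : ∀ m, ∑ a, e a * ∑ i, ‖(g' (ψ m) * star Winf) i a‖ ^ 2 = 0 := by
      intro m
      refine firstOrder_of_frobSq_minimizer T₀ (hg'det _) ?_ hstarW e hesum hsupp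
      intro M hM hMT
      exact hg'min _ M hM (hMT.trans (hg'S _))
    -- rewrite it through `KAK`: `∑ c exp(2 θ c) P m c = 0`
    set P : ℕ → σ → ℝ := fun m c => ∑ a, e a * ‖(W (ψ m) * star Winf) c a‖ ^ 2 with hP
    have hzero : ∀ m, ∑ c, Real.exp (2 * (rr (ψ m) * ε (ψ m) c)) * P m c = 0 := by
      intro m
      have h := hfo m
      have hcol : ∀ a, ∑ i, ‖(g' (ψ m) * star Winf) i a‖ ^ 2 =
          ∑ c, Real.exp (2 * θ (ψ m) c) * ‖(W (ψ m) * star Winf) c a‖ ^ 2 := by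
        intro a
        rw [hkak (ψ m), Matrix.mul_assoc]
        exact colNormSq_unitary_mul_diagonal_mul (hVV _) (θ (ψ m)) (W (ψ m) * star Winf) a
      simp_rw [hcol, Finset.mul_sum] at h
      rw [Finset.sum_comm] at h
      rw [← h]
      refine Finset.sum_congr rfl fun c _ => ?_
      rw [hP]
      simp only
      rw [Finset.mul_sum]
      refine Finset.sum_congr rfl fun a _ => ?_
      rw [hθε]
      ring
    -- the limits of `P m c`
    have hPlim : ∀ c, Tendsto (fun m => P m c) atTop (𝓝 (e c)) := by
      intro c
      have hWW : Tendsto (fun m => W (ψ m) * star Winf) atTop (𝓝 (Winf * star Winf)) :=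
        ((continuous_id.matrix_mul continuous_const).tendsto _).comp hWlim
      rw [hWinf''] at hWW
      have h1 : Tendsto (fun m => P m c) atTop
          (𝓝 (∑ a, e a * ‖(1 : Matrix σ σ ℂ) c a‖ ^ 2)) := by
        refine tendsto_finsetSum _ fun a _ => Tendsto.const_mul _ ?_
        exact ((((continuous_apply a).comp (continuous_apply c)).tendsto _).comp hWW).norm.pow 2
      have h2 : ∑ a, e a * ‖(1 : Matrix σ σ ℂ) c a‖ ^ 2 = e c := by
        simp_rw [Matrix.one_apply]
        rw [Finset.sum_eq_single c]
        · simp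
        · intro a _ hac
          rw [if_neg (Ne.symm hac)]; simp
        · intro h; exact absurd (Finset.mem_univ c) h
      rwa [h2] at h1
    -- contradiction
    have hev := eventually_pos_expSum hrlim hεlim' hPlim hepos
    obtain ⟨m, hm⟩ := hev.exists
    rw [hzero m] at hm
    exact lt_irrefl _ hm

end KempfNess

end Literature.Computability.AlgebraicComplexity
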